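import Summits.CriticalPhenomena.Ising3D.Control2DOpeConvergenceFree
import Mathlib.Analysis.SpecialFunctions.Pow.Real
import Mathlib.Tactic.Linarith
import Mathlib.Tactic.Positivity
import Mathlib.Tactic.Ring
import Mathlib.Tactic.FieldSimp
import HarnessLib

/-!
# The OPE converges geometrically and the weighted spectral density grows at most like `E^{2Δ_σ}` — for every unitary
# solution of the typed 2D sum rule at `Δ_σ > 0`
(cell `pub-ising3x`, seat controls-1 gen 44; PAPER §6.2 / Appendix E — CONTROL-ONLY; sequel to `Control2DOpeConvergenceFree`)

HONEST FRAMING: lottery ticket; floor = tightest certified 3D Ising CFT bounds; no exact-solution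
claim without a proof. CONTROL-ONLY (`d = 2`, global `sl(2) × sl(2)` blocks, `Δ_σ = s` an INPUT, axiom set
`A2D′`); nothing here is about `d = 3`, no certificate, functional or number of the record is touched, and no
new hypothesis or named fact enters.

WHAT THIS FILE ADDS. Gen 42/43 showed that every unitary solution of the typed `⟨σσσσ⟩` sum rule at `Δ_σ = s > 0` has an
absolutely convergent, crossing-symmetric `s`-channel expansion `G(z,z̄) = 1 + Σ p_i g_i(z,z̄)` on the real open square
(`opeConvergent_free`, `fourPoint_crossing_free`). This file makes the convergence QUANTITATIVE — the elementary estimates of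
Pappadopulo–Rychkov–Espin–Rattazzi 2012, §4.2 («`F(E) ≤ e^b ℒ(b/E) ≤ const · e^b b^{-2Δ_φ} E^{2Δ_φ}`, `b = 2Δ_φ`») and §4.4 (the
tail), for the typed two-dimensional class, in the `z`-coordinate on the real diagonal, every constant explicit, the
crossing-symmetric value `G(½,½)` of the datum the ONLY datum-dependent quantity:
* `globalBlock_diag_le_rpow_mul` — `g_{Δ,ℓ}(x₀,x₀) ≤ (x₀/x)^Δ g_{Δ,ℓ}(x,x)` for `0 < x₀ ≤ x < 1`, `ℓ ≤ Δ`;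
* `CrossingData.fourPoint_growth`, **`fourPoint_diag_le`** — the power law of the crossed-channel identity: `v^s G(z,z̄) ≤
  u^s G(½,½)` on `[½,1)²`, so `G(y,y) ≤ (y/(1-y))^{2s} G(½,½)` (crossing + monotonicity, `G(1-z,1-z̄) ≤ G(½,½)`);
* **`sum_p_low_le`** — the INTEGRATED WEIGHTED SPECTRAL DENSITY is polynomially bounded: `Σ'_{Δ_i ≤ E} p_i ≤
  ½ e^{2s} (E/(2s))^{2s} G(½,½)` for every `E ≥ 2s` (two-point form `two_mul_rpow_mul_sum_p_low_le`: `2x^E Σ'_{Δ_i ≤ E} p_i ≤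
  G(x,x) - 1`, at `x = E/(E+2s)`, with `(1+2s/E)^E ≤ e^{2s}`); so every squared OPE coefficient obeys **`p_le_of_le_dim`**:
  `p_i ≤ ½ e^{2s} (Δ_i/(2s))^{2s} G(½,½)` (`Δ_i ≥ 2s`), and `sum_p_low_le_at_half`: `Σ'_{Δ_i ≤ H} p_i ≤ 2^{H-1} (G(½,½) - 1)`;
* **`tail_le_two_point`**, **`tail_le`** — the CONVERGENCE RATE: `Σ'_{Δ_i ≥ E} p_i g_i(x₀,x₀) ≤ (x₀/x)^E (G(x,x) - 1)` for
  `x₀ ≤ x`, hence `≤ e^{2s} (E/(2s))^{2s} G(½,½) · x₀^E` whenever `E ≥ 2s` and `E(1-x₀) ≥ 2s·x₀`: geometric decay in the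
  cut-off with a universal polynomial prefactor; `tail_le_of_le_half` (`x₀ ≤ ½`), `tail_le_offDiag` (`z, z̄ ≤ x₀`);
* at `Δ_σ = 1/8` on the record's class (`G(½,½) ≤ G(16/17,16/17) ≤ 7/3`, gen-42 `record_fourPoint_at_sixteen_seventeenths`):
  `record_sum_p_low_le (w)` — `Σ'_{Δ_i ≤ E} p_i ≤ (7/6) e^{1/4} (4E)^{1/4}` for every `E ≥ 1/4`, no constant left;
  `record_tail_le (w)`.

NOT claimed: the Hardy–Littlewood ASYMPTOTICS `F(E) ~ E^{2s}/Γ(2s+1)` of PRER §4.2 (Tauberian; only the elementary upper bound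
is proved); any LOWER bound on the density; the `ρ`-coordinate rate of PRER §4.4/§5; anything off the REAL open square; twists;
Virasoro; anything three-dimensional; any new bound; no number of the record touched.

References: D. Pappadopulo, S. Rychkov, J. Espin, R. Rattazzi, Phys. Rev. D 86 (2012) 105043, §4.2, §4.4
[cite: PappadopuloRychkovEspinRattazzi2012PRD, §4.2]; R. Rattazzi, V. S. Rychkov, E. Tonni, A. Vichi, JHEP 12 (2008) 031, §3
[cite: RattazziEtAl2008, §3]; F. A. Dolan, H. Osborn, Nucl. Phys. B 678 (2004) 491, §3 [cite: DolanOsborn2004, §3]. Tree: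
`chiralBlock_le_rpow_mul` (`Control2DUnboundedSpin`); `two_mul_rpow_le_globalBlock_diag` (`Control2DChiralEnvelope`);
`opeConvergent_free`, `fourPoint_crossing_free` (`Control2DOpeConvergenceFree`); `fourPoint_mono`, `rpow_sq_eq_mirror_mul`,
`record_fourPoint_at_sixteen_seventeenths` (`Control2DFourPointBounds`); `globalBlock_nonneg`, `globalBlock_mono`, `one_le_fourPoint`
(`Control2DFourPoint`); `chiralBlock_nonneg` (`Control2DNonVacuity`).
Mathlib: `Summable.tsum_subtype_le/tsum_le_tsum/le_tsum`, `Real.add_one_le_exp`, `Real.exp_mul`, `Real.rpow_le_rpow_of_exponent_ge`.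
-/

namespace Summit.CriticalPhenomena.Ising3D.Control2D

open Set
open Literature.MathematicalPhysics.QuantumFieldTheory.ConformalBootstrap3D

/-! ### Scaling of a block along the diagonal -/

/-- **Scaling along the diagonal**: for a unitary label `ℓ ≤ Δ` and `0 < x₀ ≤ x < 1`,
`g_{Δ,ℓ}(x₀,x₀) ≤ (x₀/x)^Δ · g_{Δ,ℓ}(x,x)` — each chiral factor scales by at least its weight (`chiralBlock_le_rpow_mul`) and
`h + h̄ = Δ`. [folklore] -/
theorem globalBlock_diag_le_rpow_mul {Δ : ℝ} {ℓ : ℕ} (hΔ : (ℓ : ℝ) ≤ Δ) {x₀ x : ℝ} (hx₀ : 0 < x₀) (h0x : x₀ ≤ x)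
    (hx1 : x < 1) : globalBlock Δ ℓ x₀ x₀ ≤ (x₀ / x) ^ Δ * globalBlock Δ ℓ x x := by
  have hℓ : (0 : ℝ) ≤ ℓ := Nat.cast_nonneg ℓ
  have hx : 0 < x := lt_of_lt_of_le hx₀ h0x
  have hx₀I : x₀ ∈ Ioo (0 : ℝ) 1 := ⟨hx₀, lt_of_le_of_lt h0x hx1⟩
  have hθ : 0 < x₀ / x := div_pos hx₀ hx
  have A := chiralBlock_le_rpow_mul (h := (Δ + ℓ) / 2) (by linarith) hx₀ h0x hx1
  have B := chiralBlock_le_rpow_mul (h := (Δ - ℓ) / 2) (by linarith) hx₀ h0x hx1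
  have hA0 : 0 ≤ chiralBlock ((Δ + ℓ) / 2) x₀ := chiralBlock_nonneg (by linarith) hx₀I
  have hB0 : 0 ≤ chiralBlock ((Δ - ℓ) / 2) x₀ := chiralBlock_nonneg (by linarith) hx₀I
  have hsplit : (x₀ / x) ^ ((Δ + ℓ) / 2) * (x₀ / x) ^ ((Δ - ℓ) / 2) = (x₀ / x) ^ Δ := by
    rw [← Real.rpow_add hθ]; ring_nf
  unfold globalBlock
  refine (add_le_add (mul_le_mul A B hB0 (hA0.trans A)) (mul_le_mul B A hA0 (hB0.trans B))).trans_eq ?_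
  rw [← hsplit]; ring

/-- **The optimisation point** `x = E/(E+2s)` of PRER's elementary estimate (`b = 2Δ_φ`): for `0 < 2s ≤ E` it lies in
`[½,1)`, has `x/(1-x) = E/(2s)`, and `x^{-E} = (1 + 2s/E)^E ≤ e^{2s}` (`Real.add_one_le_exp`, raised to the power `E`). [folklore] -/
theorem ratePoint_spec {s E : ℝ} (hs : 0 < s) (hE : 2 * s ≤ E) :
    0 < E / (E + 2 * s) ∧ E / (E + 2 * s) < 1 ∧ 1 / 2 ≤ E / (E + 2 * s) ∧
      E / (E + 2 * s) / (1 - E / (E + 2 * s)) = E / (2 * s) ∧ ((E / (E + 2 * s)) ^ E)⁻¹ ≤ Real.exp (2 * s) := by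
  have hE0 : 0 < E := by linarith
  have hE2 : 0 < E + 2 * s := by linarith
  have hx : 0 < E / (E + 2 * s) := div_pos hE0 hE2
  refine ⟨hx, by rw [div_lt_one hE2]; linarith, by rw [le_div_iff₀ hE2]; linarith, ?_, ?_⟩
  · have h1x : 1 - E / (E + 2 * s) = 2 * s / (E + 2 * s) := by field_simp; ring
    rw [h1x, div_div_div_cancel_right₀ hE2.ne']
  · rw [← Real.inv_rpow hx.le, inv_div]
    have h1 : (E + 2 * s) / E = 2 * s / E + 1 := by field_simp; ring
    have h2 : (E + 2 * s) / E ≤ Real.exp (2 * s / E) := by rw [h1]; exact Real.add_one_le_exp _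
    have h3 : ((E + 2 * s) / E) ^ E ≤ Real.exp (2 * s / E) ^ E := Real.rpow_le_rpow (div_pos hE2 hE0).le h2 hE0.le
    rw [← Real.exp_mul, div_mul_cancel₀ _ hE0.ne'] at h3
    exact h3

namespace CrossingData

variable {D : CrossingData} {s : ℝ}

/-! ### The power law of the crossed-channel identity -/

/-- **Growth of `G` towards the corner `(1,1)`**: for every unitary solution of the typed sum rule at `s > 0` and every point of
`[½,1)²`, `v^s G(z,z̄) ≤ u^s G(½,½)` — crossing symmetry `v^s G(z,z̄) = u^s G(1-z,1-z̄)` (`fourPoint_crossing_free`) and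
monotonicity `G(1-z,1-z̄) ≤ G(½,½)` (`fourPoint_mono`). [cite: PappadopuloRychkovEspinRattazzi2012PRD, §4.2] -/
theorem fourPoint_growth (hU : D.IsUnitary) (hC : D.SatisfiesCrossing s) (hs : 0 < s) {z zb : ℝ}
    (hz2 : 1 / 2 ≤ z) (hz1 : z < 1) (hzb2 : 1 / 2 ≤ zb) (hzb1 : zb < 1) :
    ((1 - z) * (1 - zb)) ^ s * D.fourPoint z zb ≤ (z * zb) ^ s * D.fourPoint (1 / 2) (1 / 2) := by
  have hz : z ∈ Ioo (0 : ℝ) 1 := ⟨by linarith, hz1⟩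
  have hzb : zb ∈ Ioo (0 : ℝ) 1 := ⟨by linarith, hzb1⟩
  rw [fourPoint_crossing_free hU hC hs hz hzb]
  have hmono : D.fourPoint (1 - z) (1 - zb) ≤ D.fourPoint (1 / 2) (1 / 2) :=
    fourPoint_mono hU (opeConvergent_free hU hC hs) (by linarith) (by linarith) (by linarith) (by linarith)
      (by norm_num) (by norm_num)
  exact mul_le_mul_of_nonneg_left hmono (Real.rpow_nonneg (mul_pos hz.1 hzb.1).le s)

/-- **The power law of the crossed-channel identity, ratio form**: `G(y,y) ≤ (y/(1-y))^{2s} · G(½,½)` for `y ∈ [½,1)` — on the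
diagonal `G` grows at most like `(1-y)^{-2Δ_σ}` towards `y = 1`, the only datum-dependent constant being the crossing-symmetric
value `G(½,½)`. [cite: PappadopuloRychkovEspinRattazzi2012PRD, §4.2] -/
theorem fourPoint_diag_le (hU : D.IsUnitary) (hC : D.SatisfiesCrossing s) (hs : 0 < s) {y : ℝ} (hy2 : 1 / 2 ≤ y)
    (hy1 : y < 1) : D.fourPoint y y ≤ (y / (1 - y)) ^ (2 * s) * D.fourPoint (1 / 2) (1 / 2) := by
  have hy0 : 0 < y := by linarith
  have h := fourPoint_growth hU hC hs hy2 hy1 hy2 hy1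
  rw [rpow_sq_eq_mirror_mul s hy0 hy1, mul_assoc] at h
  exact le_of_mul_le_mul_left h (Real.rpow_pos_of_pos (mul_pos (by linarith) (by linarith)) s)

/-! ### The integrated weighted spectral density -/

/-- The coefficients of the labels of dimension `≤ E` are summable (for unitary data with convergent expansion: at any point of
the diagonal each such label contributes `p_i g_i(x,x) ≥ 2x^E p_i`). [folklore] -/
theorem summable_p_le_dim (hU : D.IsUnitary) (hconv : D.OpeConvergent) (E : ℝ) :
    Summable fun i : ↥({i : D.ι | D.Δ i ≤ E} : Set D.ι) => D.p i := by
  have hx : (1 / 2 : ℝ) ∈ Ioo (0 : ℝ) 1 := ⟨by norm_num, by norm_num⟩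
  have hc : 0 < 2 * (1 / 2 : ℝ) ^ E := by positivity
  have S := ((hconv (1 / 2) (1 / 2) hx hx).subtype ({i : D.ι | D.Δ i ≤ E} : Set D.ι)).mul_left (2 * (1 / 2 : ℝ) ^ E)⁻¹
  refine S.of_nonneg_of_le (fun i => (hU i).2.2) fun i => ?_
  have hi : D.Δ (i : D.ι) ≤ E := i.2
  have hpow : (1 / 2 : ℝ) ^ E ≤ (1 / 2 : ℝ) ^ D.Δ i :=
    Real.rpow_le_rpow_of_exponent_ge (by norm_num) (by norm_num) hi
  have hg := two_mul_rpow_le_globalBlock_diag (hU i).2.1 (x := 1 / 2) (by norm_num) (by norm_num)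
  have hp0 : 0 ≤ D.p i := (hU i).2.2
  have h1 : 2 * (1 / 2 : ℝ) ^ E * D.p i ≤ D.p i * globalBlock (D.Δ i) (D.spin i) (1 / 2) (1 / 2) := by nlinarith
  simp only [Function.comp_apply]
  calc D.p i = (2 * (1 / 2 : ℝ) ^ E)⁻¹ * (2 * (1 / 2 : ℝ) ^ E * D.p i) := by field_simp
    _ ≤ (2 * (1 / 2 : ℝ) ^ E)⁻¹ * (D.p i * globalBlock (D.Δ i) (D.spin i) (1 / 2) (1 / 2)) :=
      mul_le_mul_of_nonneg_left h1 (inv_nonneg.mpr hc.le)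

/-- **Two-point form of the density bound** (PRER's «obvious estimate» `ℒ(β) ≥ e^{-Eβ} F(E)`): at every diagonal point `x`,
`2 x^E · Σ'_{Δ_i ≤ E} p_i ≤ G(x,x) - 1`. NORMALISATION behind the factor `2`: the tree's `globalBlock Δ ℓ` is the symmetrised
product `k_{2h}(z) k_{2h̄}(z̄) + k_{2h̄}(z) k_{2h}(z̄)` for EVERY `ℓ`, scalars included, so on the diagonal
`g_{Δ,ℓ}(x,x) = 2 k_{2h}(x) k_{2h̄}(x) ≥ 2 x^{h} x^{h̄} = 2 x^{Δ}` (`k_{2h}(x) ≥ x^h`, `two_mul_rpow_le_globalBlock_diag`); hence each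
label of dimension `≤ E` contributes `p_i g_i(x,x) ≥ 2 p_i x^{Δ_i} ≥ 2 p_i x^E`, and the partial sum is at most the whole
`G(x,x) - 1`. [cite: PappadopuloRychkovEspinRattazzi2012PRD, §4.2] -/
theorem two_mul_rpow_mul_sum_p_low_le (hU : D.IsUnitary) (hconv : D.OpeConvergent) {x : ℝ} (hx : x ∈ Ioo (0 : ℝ) 1)
    (E : ℝ) : 2 * x ^ E * ∑' i : ↥({i : D.ι | D.Δ i ≤ E} : Set D.ι), D.p i ≤ D.fourPoint x x - 1 := by
  set T : Set D.ι := {i : D.ι | D.Δ i ≤ E} with hT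
  have hS := hconv x x hx hx
  have hST : Summable fun i : ↥T => D.p i * globalBlock (D.Δ i) (D.spin i) x x := hS.subtype T
  have hP := summable_p_le_dim hU hconv E
  have hle : ∀ i : ↥T, 2 * x ^ E * D.p i ≤ D.p i * globalBlock (D.Δ i) (D.spin i) x x := by
    intro i
    have hi : D.Δ (i : D.ι) ≤ E := i.2
    have hpow : x ^ E ≤ x ^ D.Δ i := Real.rpow_le_rpow_of_exponent_ge hx.1 hx.2.le hi
    have hg := two_mul_rpow_le_globalBlock_diag (hU i).2.1 hx.1 hx.2
    have hp0 : 0 ≤ D.p i := (hU i).2.2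
    nlinarith
  have h1 : 2 * x ^ E * ∑' i : ↥T, D.p i ≤ ∑' i : ↥T, D.p i * globalBlock (D.Δ i) (D.spin i) x x := by
    rw [← tsum_mul_left]
    exact (hP.mul_left _).tsum_le_tsum hle hST
  have h2 : ∑' i : ↥T, D.p i * globalBlock (D.Δ i) (D.spin i) x x ≤ ∑' i, D.p i * globalBlock (D.Δ i) (D.spin i) x x :=
    hS.tsum_subtype_le _ T (fun i => mul_nonneg (hU i).2.2 (globalBlock_nonneg (hU i).2.1 hx hx))
  have h3 : D.fourPoint x x - 1 = ∑' i, D.p i * globalBlock (D.Δ i) (D.spin i) x x := by unfold fourPoint; ring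
  linarith

/-- **At the crossing-symmetric point**: `Σ'_{Δ_i ≤ H} p_i ≤ 2^{H-1} (G(½,½) - 1)` for every `H` (the two-point form at `x = ½`).
[cite: PappadopuloRychkovEspinRattazzi2012PRD, §4.2] -/
theorem sum_p_low_le_at_half (hU : D.IsUnitary) (hconv : D.OpeConvergent) (H : ℝ) :
    ∑' i : ↥({i : D.ι | D.Δ i ≤ H} : Set D.ι), D.p i ≤ (2 : ℝ) ^ (H - 1) * (D.fourPoint (1 / 2) (1 / 2) - 1) := by
  have h := two_mul_rpow_mul_sum_p_low_le hU hconv (x := 1 / 2) ⟨by norm_num, by norm_num⟩ H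
  have hc : 0 < 2 * (1 / 2 : ℝ) ^ H := by positivity
  have hinv : (2 : ℝ) ^ (H - 1) * (2 * (1 / 2 : ℝ) ^ H) = 1 := by
    rw [one_div, Real.inv_rpow (by norm_num : (0 : ℝ) ≤ 2), Real.rpow_sub (by norm_num : (0 : ℝ) < 2), Real.rpow_one]
    field_simp
  calc ∑' i : ↥({i : D.ι | D.Δ i ≤ H} : Set D.ι), D.p i
      = (2 : ℝ) ^ (H - 1) * (2 * (1 / 2 : ℝ) ^ H * ∑' i : ↥({i : D.ι | D.Δ i ≤ H} : Set D.ι), D.p i) := by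
        rw [← mul_assoc, hinv, one_mul]
    _ ≤ (2 : ℝ) ^ (H - 1) * (D.fourPoint (1 / 2) (1 / 2) - 1) :=
        mul_le_mul_of_nonneg_left h (Real.rpow_nonneg (by norm_num) _)

/-- **The integrated weighted spectral density is polynomially bounded** (Pappadopulo–Rychkov–Espin–Rattazzi 2012, §4.2, the
elementary bound with `b = 2Δ_φ` — elementary upper bound only, not the Hardy–Littlewood asymptotics): for every unitary solution
of the typed sum rule at `Δ_σ = s > 0` and every `E ≥ 2s`, `Σ'_{Δ_i ≤ E} p_i ≤ ½ · e^{2s} · (E/(2s))^{2s} · G(½,½)` (the `½` is the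
normalisation factor of `two_mul_rpow_mul_sum_p_low_le`). Proof: the two-point form at `x = E/(E+2s) ∈ [½,1)`, the growth bound
`G(x,x) - 1 ≤ G(x,x) ≤ (x/(1-x))^{2s} G(½,½) = (E/(2s))^{2s} G(½,½)`, and `x^{-E} = (1+2s/E)^E ≤ e^{2s}`.
[cite: PappadopuloRychkovEspinRattazzi2012PRD, §4.2] -/
theorem sum_p_low_le (hU : D.IsUnitary) (hC : D.SatisfiesCrossing s) (hs : 0 < s) {E : ℝ} (hE : 2 * s ≤ E) :
    ∑' i : ↥({i : D.ι | D.Δ i ≤ E} : Set D.ι), D.p i ≤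
      1 / 2 * Real.exp (2 * s) * (E / (2 * s)) ^ (2 * s) * D.fourPoint (1 / 2) (1 / 2) := by
  have hconv := opeConvergent_free hU hC hs
  have hE0 : 0 < E := by linarith
  obtain ⟨hx0, hx1, hx2, hratio, hinv⟩ := ratePoint_spec hs hE
  set x : ℝ := E / (E + 2 * s) with hxdef
  have h1 := two_mul_rpow_mul_sum_p_low_le hU hconv ⟨hx0, hx1⟩ E
  have h2 := fourPoint_diag_le hU hC hs hx2 hx1
  rw [hratio] at h2
  have hG1 := one_le_fourPoint hU (z := x) (zb := x) ⟨hx0, hx1⟩ ⟨hx0, hx1⟩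
  have hxE : 0 < x ^ E := Real.rpow_pos_of_pos hx0 E
  set S := ∑' i : ↥({i : D.ι | D.Δ i ≤ E} : Set D.ι), D.p i with hSdef
  have hS0 : 0 ≤ S := tsum_nonneg fun i => (hU i).2.2
  have hA : 0 ≤ (E / (2 * s)) ^ (2 * s) * D.fourPoint (1 / 2) (1 / 2) :=
    mul_nonneg (Real.rpow_nonneg (div_pos hE0 (by linarith)).le _) (by
      have := one_le_fourPoint hU (z := 1 / 2) (zb := 1 / 2) ⟨by norm_num, by norm_num⟩ ⟨by norm_num, by norm_num⟩
      linarith)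
  -- `2 x^E S ≤ G(x,x) - 1 ≤ (E/2s)^{2s} G(½,½)`, then divide by `2 x^E` and use `(x^E)⁻¹ ≤ e^{2s}`
  have h3 : 2 * x ^ E * S ≤ (E / (2 * s)) ^ (2 * s) * D.fourPoint (1 / 2) (1 / 2) := by linarith
  have h4 : S * x ^ E ≤ 1 / 2 * ((E / (2 * s)) ^ (2 * s) * D.fourPoint (1 / 2) (1 / 2)) := by nlinarith [h3]
  calc S = (x ^ E)⁻¹ * (S * x ^ E) := by field_simp
    _ ≤ (x ^ E)⁻¹ * (1 / 2 * ((E / (2 * s)) ^ (2 * s) * D.fourPoint (1 / 2) (1 / 2))) :=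
        mul_le_mul_of_nonneg_left h4 (inv_nonneg.mpr hxE.le)
    _ ≤ Real.exp (2 * s) * (1 / 2 * ((E / (2 * s)) ^ (2 * s) * D.fourPoint (1 / 2) (1 / 2))) :=
        mul_le_mul_of_nonneg_right hinv (by positivity)
    _ = _ := by ring

/-- **Every squared OPE coefficient is polynomially bounded in the dimension**: for every unitary solution of the typed sum rule
at `s > 0` and every label with `Δ_i ≥ 2s`, `p_i ≤ ½ e^{2s} (Δ_i/(2s))^{2s} G(½,½)` (a single term is at most the partial sum
over `{Δ_j ≤ Δ_i}`). [cite: PappadopuloRychkovEspinRattazzi2012PRD, §4.2] -/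
theorem p_le_of_le_dim (hU : D.IsUnitary) (hC : D.SatisfiesCrossing s) (hs : 0 < s) (i : D.ι) (hi : 2 * s ≤ D.Δ i) :
    D.p i ≤ 1 / 2 * Real.exp (2 * s) * (D.Δ i / (2 * s)) ^ (2 * s) * D.fourPoint (1 / 2) (1 / 2) := by
  have hP := summable_p_le_dim hU (opeConvergent_free hU hC hs) (D.Δ i)
  have h1 : D.p i ≤ ∑' j : ↥({j : D.ι | D.Δ j ≤ D.Δ i} : Set D.ι), D.p j :=
    hP.le_tsum ⟨i, (le_rfl : D.Δ i ≤ D.Δ i)⟩ fun j _ => (hU j).2.2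
  exact h1.trans (sum_p_low_le hU hC hs hi)

/-! ### The convergence rate -/

/-- **Two-point tail bound** (PRER §4.4 in the `z`-coordinate): for unitary data with convergent expansion and
`0 < x₀ ≤ x < 1`, the tail of the expansion above dimension `E` at `(x₀,x₀)` is at most `(x₀/x)^E` times the tail at `(x,x)`:
`Σ'_{Δ_i ≥ E} p_i g_i(x₀,x₀) ≤ (x₀/x)^E · Σ'_{Δ_i ≥ E} p_i g_i(x,x)` (`globalBlock_diag_le_rpow_mul` and `(x₀/x)^{Δ_i} ≤ (x₀/x)^E`).
[cite: PappadopuloRychkovEspinRattazzi2012PRD, §4.4] -/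
theorem tail_le_rpow_mul_tail (hU : D.IsUnitary) (hconv : D.OpeConvergent) {x₀ x : ℝ} (hx₀ : 0 < x₀) (h0x : x₀ ≤ x)
    (hx1 : x < 1) (E : ℝ) :
    ∑' i : ↥({i : D.ι | E ≤ D.Δ i} : Set D.ι), D.p i * globalBlock (D.Δ i) (D.spin i) x₀ x₀ ≤
      (x₀ / x) ^ E * ∑' i : ↥({i : D.ι | E ≤ D.Δ i} : Set D.ι), D.p i * globalBlock (D.Δ i) (D.spin i) x x := by
  set T : Set D.ι := {i : D.ι | E ≤ D.Δ i} with hT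
  have hx : 0 < x := lt_of_lt_of_le hx₀ h0x
  have hxI : x ∈ Ioo (0 : ℝ) 1 := ⟨hx, hx1⟩
  have hx₀I : x₀ ∈ Ioo (0 : ℝ) 1 := ⟨hx₀, lt_of_le_of_lt h0x hx1⟩
  have hθ0 : 0 < x₀ / x := div_pos hx₀ hx
  have hθ1 : x₀ / x ≤ 1 := (div_le_one hx).mpr h0x
  have hS0 : Summable fun i : ↥T => D.p i * globalBlock (D.Δ i) (D.spin i) x₀ x₀ := (hconv x₀ x₀ hx₀I hx₀I).subtype T
  have hS : Summable fun i : ↥T => D.p i * globalBlock (D.Δ i) (D.spin i) x x := (hconv x x hxI hxI).subtype T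
  rw [← tsum_mul_left]
  refine hS0.tsum_le_tsum (fun i => ?_) (hS.mul_left _)
  have hi : E ≤ D.Δ (i : D.ι) := i.2
  have hg := globalBlock_diag_le_rpow_mul (hU i).2.1 hx₀ h0x hx1
  have hpow : (x₀ / x) ^ D.Δ i ≤ (x₀ / x) ^ E := Real.rpow_le_rpow_of_exponent_ge hθ0 hθ1 hi
  have hg0 : 0 ≤ globalBlock (D.Δ i) (D.spin i) x x := globalBlock_nonneg (hU i).2.1 hxI hxI
  have hp0 : 0 ≤ D.p i := (hU i).2.2
  calc D.p i * globalBlock (D.Δ i) (D.spin i) x₀ x₀ ≤ D.p i * ((x₀ / x) ^ D.Δ i * globalBlock (D.Δ i) (D.spin i) x x) :=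
        mul_le_mul_of_nonneg_left hg hp0
    _ ≤ D.p i * ((x₀ / x) ^ E * globalBlock (D.Δ i) (D.spin i) x x) :=
        mul_le_mul_of_nonneg_left (mul_le_mul_of_nonneg_right hpow hg0) hp0
    _ = (x₀ / x) ^ E * (D.p i * globalBlock (D.Δ i) (D.spin i) x x) := by ring

/-- **Two-point tail bound against the four-point function**: `Σ'_{Δ_i ≥ E} p_i g_i(x₀,x₀) ≤ (x₀/x)^E (G(x,x) - 1)` for
`0 < x₀ ≤ x < 1`. [cite: PappadopuloRychkovEspinRattazzi2012PRD, §4.4] -/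
theorem tail_le_two_point (hU : D.IsUnitary) (hconv : D.OpeConvergent) {x₀ x : ℝ} (hx₀ : 0 < x₀) (h0x : x₀ ≤ x)
    (hx1 : x < 1) (E : ℝ) :
    ∑' i : ↥({i : D.ι | E ≤ D.Δ i} : Set D.ι), D.p i * globalBlock (D.Δ i) (D.spin i) x₀ x₀ ≤
      (x₀ / x) ^ E * (D.fourPoint x x - 1) := by
  have hx : 0 < x := lt_of_lt_of_le hx₀ h0x
  have hxI : x ∈ Ioo (0 : ℝ) 1 := ⟨hx, hx1⟩
  have h1 := tail_le_rpow_mul_tail hU hconv hx₀ h0x hx1 E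
  have h2 : ∑' i : ↥({i : D.ι | E ≤ D.Δ i} : Set D.ι), D.p i * globalBlock (D.Δ i) (D.spin i) x x ≤
      ∑' i, D.p i * globalBlock (D.Δ i) (D.spin i) x x :=
    (hconv x x hxI hxI).tsum_subtype_le _ _ (fun i => mul_nonneg (hU i).2.2 (globalBlock_nonneg (hU i).2.1 hxI hxI))
  have h3 : D.fourPoint x x - 1 = ∑' i, D.p i * globalBlock (D.Δ i) (D.spin i) x x := by unfold fourPoint; ring
  rw [h3]
  exact h1.trans (mul_le_mul_of_nonneg_left h2 (Real.rpow_nonneg (div_pos hx₀ hx).le _))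

/-- **The convergence rate** (Pappadopulo–Rychkov–Espin–Rattazzi 2012, §4.4, elementary form in the `z`-coordinate): for every
unitary solution of the typed sum rule at `Δ_σ = s > 0`, every diagonal point `x₀ ∈ (0,1)` and every cut-off `E` with `E ≥ 2s`
and `E(1-x₀) ≥ 2s·x₀`, the tail of the `s`-channel expansion obeys
`Σ'_{Δ_i ≥ E} p_i g_i(x₀,x₀) ≤ e^{2s} · (E/(2s))^{2s} · G(½,½) · x₀^E` — GEOMETRIC decay in `E` with a universal polynomial
prefactor (the two-point bound at `x = E/(E+2s) ≥ max(x₀,½)` and the growth bound at `x`).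
[cite: PappadopuloRychkovEspinRattazzi2012PRD, §4.4] -/
theorem tail_le (hU : D.IsUnitary) (hC : D.SatisfiesCrossing s) (hs : 0 < s) {x₀ E : ℝ} (hx₀ : 0 < x₀)
    (hE : 2 * s ≤ E) (hEx : 2 * s * x₀ ≤ E * (1 - x₀)) :
    ∑' i : ↥({i : D.ι | E ≤ D.Δ i} : Set D.ι), D.p i * globalBlock (D.Δ i) (D.spin i) x₀ x₀ ≤
      Real.exp (2 * s) * (E / (2 * s)) ^ (2 * s) * D.fourPoint (1 / 2) (1 / 2) * x₀ ^ E := by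
  have hconv := opeConvergent_free hU hC hs
  have hE0 : 0 < E := by linarith
  have hE2 : 0 < E + 2 * s := by linarith
  have h0x : x₀ ≤ E / (E + 2 * s) := by rw [le_div_iff₀ hE2]; linarith
  obtain ⟨hx0, hx1, hx2, hratio, hinv⟩ := ratePoint_spec hs hE
  set x : ℝ := E / (E + 2 * s) with hxdef
  have h1 := tail_le_two_point hU hconv hx₀ h0x hx1 E
  have h2 := fourPoint_diag_le hU hC hs hx2 hx1
  rw [hratio] at h2
  have hxE : 0 < x ^ E := Real.rpow_pos_of_pos hx0 E
  have hsplit : (x₀ / x) ^ E = x₀ ^ E * (x ^ E)⁻¹ := by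
    rw [Real.div_rpow hx₀.le hx0.le, div_eq_mul_inv]
  have hA : 0 ≤ (E / (2 * s)) ^ (2 * s) * D.fourPoint (1 / 2) (1 / 2) :=
    mul_nonneg (Real.rpow_nonneg (div_pos hE0 (by linarith)).le _) (by
      have := one_le_fourPoint hU (z := 1 / 2) (zb := 1 / 2) ⟨by norm_num, by norm_num⟩ ⟨by norm_num, by norm_num⟩
      linarith)
  have hx₀E : 0 ≤ x₀ ^ E := Real.rpow_nonneg hx₀.le E
  calc ∑' i : ↥({i : D.ι | E ≤ D.Δ i} : Set D.ι), D.p i * globalBlock (D.Δ i) (D.spin i) x₀ x₀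
      ≤ (x₀ / x) ^ E * (D.fourPoint x x - 1) := h1
    _ ≤ (x₀ / x) ^ E * ((E / (2 * s)) ^ (2 * s) * D.fourPoint (1 / 2) (1 / 2)) :=
        mul_le_mul_of_nonneg_left (by linarith) (Real.rpow_nonneg (div_pos hx₀ hx0).le _)
    _ = x₀ ^ E * ((x ^ E)⁻¹ * ((E / (2 * s)) ^ (2 * s) * D.fourPoint (1 / 2) (1 / 2))) := by rw [hsplit]; ring
    _ ≤ x₀ ^ E * (Real.exp (2 * s) * ((E / (2 * s)) ^ (2 * s) * D.fourPoint (1 / 2) (1 / 2))) :=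
        mul_le_mul_of_nonneg_left (mul_le_mul_of_nonneg_right hinv hA) hx₀E
    _ = _ := by ring

/-- **The rate at points `x₀ ≤ ½`**: there the side condition `E(1-x₀) ≥ 2s x₀` follows from `E ≥ 2s`, so
`Σ'_{Δ_i ≥ E} p_i g_i(x₀,x₀) ≤ e^{2s} (E/(2s))^{2s} G(½,½) x₀^E` for every `E ≥ 2s`. [cite: PappadopuloRychkovEspinRattazzi2012PRD, §4.4] -/
theorem tail_le_of_le_half (hU : D.IsUnitary) (hC : D.SatisfiesCrossing s) (hs : 0 < s) {x₀ E : ℝ} (hx₀ : 0 < x₀)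
    (hx₀2 : x₀ ≤ 1 / 2) (hE : 2 * s ≤ E) :
    ∑' i : ↥({i : D.ι | E ≤ D.Δ i} : Set D.ι), D.p i * globalBlock (D.Δ i) (D.spin i) x₀ x₀ ≤
      Real.exp (2 * s) * (E / (2 * s)) ^ (2 * s) * D.fourPoint (1 / 2) (1 / 2) * x₀ ^ E :=
  tail_le hU hC hs hx₀ hE (by nlinarith)

/-- **Off the diagonal**: for `z, z̄ ≤ x₀ < 1` the tail at `(z,z̄)` is at most the tail at `(x₀,x₀)` (`globalBlock_mono`), so the
rate bound holds at every point of the square dominated by `(x₀,x₀)`. [cite: PappadopuloRychkovEspinRattazzi2012PRD, §4.4] -/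
theorem tail_le_offDiag (hU : D.IsUnitary) (hC : D.SatisfiesCrossing s) (hs : 0 < s) {z zb x₀ E : ℝ} (hz : 0 < z)
    (hzb : 0 < zb) (hzx : z ≤ x₀) (hzbx : zb ≤ x₀) (hx₀1 : x₀ < 1) (hE : 2 * s ≤ E)
    (hEx : 2 * s * x₀ ≤ E * (1 - x₀)) :
    ∑' i : ↥({i : D.ι | E ≤ D.Δ i} : Set D.ι), D.p i * globalBlock (D.Δ i) (D.spin i) z zb ≤
      Real.exp (2 * s) * (E / (2 * s)) ^ (2 * s) * D.fourPoint (1 / 2) (1 / 2) * x₀ ^ E := by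
  have hconv := opeConvergent_free hU hC hs
  have hx₀ : 0 < x₀ := lt_of_lt_of_le hz hzx
  have hzI : z ∈ Ioo (0 : ℝ) 1 := ⟨hz, lt_of_le_of_lt hzx hx₀1⟩
  have hzbI : zb ∈ Ioo (0 : ℝ) 1 := ⟨hzb, lt_of_le_of_lt hzbx hx₀1⟩
  have hx₀I : x₀ ∈ Ioo (0 : ℝ) 1 := ⟨hx₀, hx₀1⟩
  set T : Set D.ι := {i : D.ι | E ≤ D.Δ i} with hT
  have h1 : ∑' i : ↥T, D.p i * globalBlock (D.Δ i) (D.spin i) z zb ≤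
      ∑' i : ↥T, D.p i * globalBlock (D.Δ i) (D.spin i) x₀ x₀ :=
    ((hconv z zb hzI hzbI).subtype T).tsum_le_tsum
      (fun i => mul_le_mul_of_nonneg_left (globalBlock_mono (hU i).2.1 hz hzb hzx hzbx hx₀1 hx₀1) (hU i).2.2)
      ((hconv x₀ x₀ hx₀I hx₀I).subtype T)
  exact h1.trans (tail_le hU hC hs hx₀ hE hEx)

end CrossingData

/-! ### The record's class at `Δ_σ = 1/8` -/

/-- **At `Δ_σ = 1/8`, for every datum of the record's class** (unitary, typed sum rule, spin 2 in `{2} ∪ [3,∞)`, scalars in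
`{x} ∪ [2,∞)` with `w ≤ x`): `G(½,½) ≤ G(16/17,16/17) ≤ 7/3` (monotonicity + gen-42 `record_fourPoint_at_sixteen_seventeenths`).
CONTROL-ONLY. [folklore] -/
theorem record_fourPoint_half_le (w : ℝ) (D : CrossingData) (hU : D.IsUnitary) (hC : D.SatisfiesCrossing (1 / 8))
    (hT : D.SpinTwoIn ({2} ∪ Ici (2 + 1))) (x : ℝ) (hwx : w ≤ x) (hS : D.ScalarsIn ({x} ∪ Ici 2)) :
    D.fourPoint (1 / 2) (1 / 2) ≤ 7 / 3 := by
  have hconv := CrossingData.opeConvergent_free hU hC (by norm_num)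
  have h1 := CrossingData.fourPoint_mono hU hconv (z := 1 / 2) (zb := 1 / 2) (z' := 16 / 17) (zb' := 16 / 17)
    (by norm_num) (by norm_num) (by norm_num) (by norm_num) (by norm_num) (by norm_num)
  have h2 := (record_fourPoint_at_sixteen_seventeenths w D hU hC hT x hwx hS).2
  linarith

/-- **The integrated spectral density of every datum of the record's class at `Δ_σ = 1/8`**: for every `E ≥ 1/4`,
`Σ'_{Δ_i ≤ E} p_i ≤ (7/6) · e^{1/4} · (4E)^{1/4}` — fully explicit, no datum-dependent constant left. CONTROL-ONLY; no certificate
or number of the record is touched (the record enters only through `x > 0.99` and the envelope at `16/17`). [folklore] -/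
theorem record_sum_p_low_le (w : ℝ) (D : CrossingData) (hU : D.IsUnitary) (hC : D.SatisfiesCrossing (1 / 8))
    (hT : D.SpinTwoIn ({2} ∪ Ici (2 + 1))) (x : ℝ) (hwx : w ≤ x) (hS : D.ScalarsIn ({x} ∪ Ici 2)) {E : ℝ}
    (hE : 1 / 4 ≤ E) :
    ∑' i : ↥({i : D.ι | D.Δ i ≤ E} : Set D.ι), D.p i ≤ 7 / 6 * Real.exp (1 / 4) * (4 * E) ^ (1 / 4 : ℝ) := by
  have h := CrossingData.sum_p_low_le hU hC (s := 1 / 8) (by norm_num) (E := E) (by linarith)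
  have hG := record_fourPoint_half_le w D hU hC hT x hwx hS
  rw [show (2 * (1 / 8 : ℝ)) = 1 / 4 by norm_num, show E / (1 / 4 : ℝ) = 4 * E by ring] at h
  have hA : 0 ≤ 1 / 2 * Real.exp (1 / 4) * (4 * E) ^ (1 / 4 : ℝ) := by positivity
  calc ∑' i : ↥({i : D.ι | D.Δ i ≤ E} : Set D.ι), D.p i
      ≤ 1 / 2 * Real.exp (1 / 4) * (4 * E) ^ (1 / 4 : ℝ) * D.fourPoint (1 / 2) (1 / 2) := h
    _ ≤ 1 / 2 * Real.exp (1 / 4) * (4 * E) ^ (1 / 4 : ℝ) * (7 / 3) := mul_le_mul_of_nonneg_left hG hA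
    _ = _ := by ring

/-- **The convergence rate of every datum of the record's class at `Δ_σ = 1/8`**: at every diagonal point `x₀ ≤ ½` and every
cut-off `E ≥ 1/4`, `Σ'_{Δ_i ≥ E} p_i g_i(x₀,x₀) ≤ (7/3) e^{1/4} (4E)^{1/4} · x₀^E`. CONTROL-ONLY. [folklore] -/
theorem record_tail_le (w : ℝ) (D : CrossingData) (hU : D.IsUnitary) (hC : D.SatisfiesCrossing (1 / 8))
    (hT : D.SpinTwoIn ({2} ∪ Ici (2 + 1))) (x : ℝ) (hwx : w ≤ x) (hS : D.ScalarsIn ({x} ∪ Ici 2)) {x₀ E : ℝ}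
    (hx₀ : 0 < x₀) (hx₀2 : x₀ ≤ 1 / 2) (hE : 1 / 4 ≤ E) :
    ∑' i : ↥({i : D.ι | E ≤ D.Δ i} : Set D.ι), D.p i * globalBlock (D.Δ i) (D.spin i) x₀ x₀ ≤
      7 / 3 * Real.exp (1 / 4) * (4 * E) ^ (1 / 4 : ℝ) * x₀ ^ E := by
  have h := CrossingData.tail_le_of_le_half hU hC (s := 1 / 8) (by norm_num) hx₀ hx₀2 (E := E) (by linarith)
  have hG := record_fourPoint_half_le w D hU hC hT x hwx hS
  rw [show (2 * (1 / 8 : ℝ)) = 1 / 4 by norm_num, show E / (1 / 4 : ℝ) = 4 * E by ring] at h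
  have hA : 0 ≤ Real.exp (1 / 4) * (4 * E) ^ (1 / 4 : ℝ) := by positivity
  have hx₀E : 0 ≤ x₀ ^ E := Real.rpow_nonneg hx₀.le E
  calc ∑' i : ↥({i : D.ι | E ≤ D.Δ i} : Set D.ι), D.p i * globalBlock (D.Δ i) (D.spin i) x₀ x₀
      ≤ Real.exp (1 / 4) * (4 * E) ^ (1 / 4 : ℝ) * D.fourPoint (1 / 2) (1 / 2) * x₀ ^ E := h
    _ ≤ Real.exp (1 / 4) * (4 * E) ^ (1 / 4 : ℝ) * (7 / 3) * x₀ ^ E :=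
        mul_le_mul_of_nonneg_right (mul_le_mul_of_nonneg_left hG hA) hx₀E
    _ = _ := by ring

end Summit.CriticalPhenomena.Ising3D.Control2D
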